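import Literature.NumberTheory.Automorphic.CuspidalCohomologyHeckeLocal
import Literature.NumberTheory.Automorphic.HeckeLocalSumFixedRepresentative
import Literature.NumberTheory.Automorphic.GKCohomologyInvariantClasses
import Literature.NumberTheory.Automorphic.OpenCompactLevelGL
import Literature.NumberTheory.Automorphic.UnramifiedHeckeLevel
import Literature.NumberTheory.Automorphic.HeckeAlgebra
import Literature.NumberTheory.Automorphic.AutomorphicRepsGLSatakeFlathProofs
import Mathlib.LinearAlgebra.PiTensorProduct.Finite
import HarnessLib

/-!
# Hecke operators on `H^q(𝔤, K_∞; π ⊗ E_wt(ℂ))^U` act by the Satake scalars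

Topic `NumberTheory/Automorphic`; namespace
`Literature.NumberTheory.Automorphic.CuspidalAutomorphicRepData`. Theorems only (no definition, no
named fact, no `sorry`).

For a cuspidal automorphic representation `π = W / W'` of `GL_n(𝔸_F)` (Borel–Jacquet model,
`CuspidalAutomorphicRepData n F hcpt`), a weight `wt`, a compact open `U ≤ GL_n(𝔸_F^∞)` and a
degree `q`, the tree's Hecke operators `T_{w,j} = [U t_{w,j} U]` on the level-`U` relative Lie
algebra cohomology `H^q(𝔤_∞, K_∞; π ⊗ E_wt(ℂ))^U` (`heckeTWt`, `cohomologyWtLevel` of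
`CuspidalCohomologyArchCoeff`) act, at all but finitely many places `w`, by the SATAKE SCALARS
`q_w^{j(n-j)/2} e_j(α_w)` of a Satake parameter `α_w` of `π` at `w`:

* `exists_finite_heckeTWt_eq_satake_smul` (hypothesis `hS`: the tree's per-`π` statement
  `AutomorphicRepData.Flath1979_heckeOperator_ofLocal_sub_smul_mem`, unramified Hecke operators act
  on `π^{K(𝔫)}` by the Satake scalars modulo `W'`) and the unconditional
  `exists_finite_heckeTWt_eq_satake_smul'` (that statement is the tree's theorem
  `AutomorphicRepData.Flath1979_heckeOperator_ofLocal_sub_smul_mem_holds`).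

This is the glue "(𝔤, K_∞)-cohomology classes of `π ⊗ E` at level `U` carry the Hecke eigenvalues
of `π_f^U`" of the Eichler–Shimura–Harder isomorphism (Harder 1987, §3; Borel–Wallach VII §2), in
the tree's concrete vocabulary.  Assembly of: a level `K(𝔫)`, `𝔫 = 𝔫_U · 𝔫_π`, with
`sndHom K(𝔫_U) ⊆ U` (`BigHeckeGLn.exists_principalCongruenceLevel_sndHom_mem`) and `K(𝔫_π)` fixing a
form of `W ∖ W'` (`AutomorphicRepData.exists_principalCongruenceLevel_fixed`); the good places of
`U` (`BigHeckeGLn.exists_goodPlaces`); `T_{w,j} ξ = H^q(A ⊗ 1) ξ` with `A = ∑_y r(ι_w y)` over a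
transversal of `GL_n(𝒪_w) t_{w,j} GL_n(𝒪_w) / GL_n(𝒪_w)`
(`heckeTWt_eq_rTensorCohomologyHom_sum`); `A` is the Satake scalar on `π^{K_f(𝔫)}`
(`exists_hasSatakeParamAt_and_sum_rightTranslation_sub_smul_mem_of_sub_mem`); and
`H^q(A ⊗ 1)` is that scalar on `K_f(𝔫)`-invariant classes
(`AutomorphicRepData.rTensorCohomologyHom_eq_smul_of_forall_fixed`).

## References
* [Harder1987] G. Harder, *Eisenstein cohomology of arithmetic groups. The case GL₂*,
  Invent. math. 89 (1987), §3.
* [FlathCorvallis1979] D. Flath, *Decomposition of representations into tensor products*,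
  Corvallis 1979, Thm. 3.
* [BorelWallach2000] A. Borel, N. Wallach, 2nd ed., I §5.1, VII §2.
* [BorelJacquetCorvallis1979] A. Borel, H. Jacquet, Corvallis 1979, §4.2 (a), §4.6.
-/

noncomputable section

namespace Literature.NumberTheory.Automorphic

namespace CuspidalAutomorphicRepData

open RealMatrixGroup ParallelWeight MulAction IsDedekindDomain
open scoped MatrixGroups Classical TensorProduct
open scoped _root_.NumberField
open _root_.NumberField

variable {F : Type} [Field F] [NumberField F] {n : ℕ} {hcpt : isCompact_glFiniteIntegralLevel n F}
  (π : CuspidalAutomorphicRepData n F hcpt) (wt : Fin n → ℤ)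
  (U : Subgroup (BigHeckeGLn.FiniteAdelicGL n F))

/-- `K_f(𝔫) ∩ G(𝔸_f)` (the principal congruence subgroup pulled back to the finite-adelic group of
the datum) is compact. [cite: BorelJacquetCorvallis1979, §4.2 (a)] -/
theorem isCompact_comap_subtype_principalCongruenceLevel {𝔫 : Ideal (𝓞 F)} (h𝔫 : 𝔫 ≠ 0) :
    IsCompact (((principalCongruenceLevel n F 𝔫).comap
      (AutomorphyDatum.gl n F hcpt).finiteAdelic.subtype :
        Subgroup (AutomorphyDatum.gl n F hcpt).finiteAdelic) :
          Set (AutomorphyDatum.gl n F hcpt).finiteAdelic) := by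
  have hcont : Continuous (GLn.ofFinite n F).rangeRestrict :=
    (GLn.continuous_ofFinite n F).subtype_mk _
  have e : (((principalCongruenceLevel n F 𝔫).comap
      (AutomorphyDatum.gl n F hcpt).finiteAdelic.subtype :
        Subgroup (AutomorphyDatum.gl n F hcpt).finiteAdelic) :
          Set (AutomorphyDatum.gl n F hcpt).finiteAdelic) =
      (GLn.ofFinite n F).rangeRestrict ''
        (((principalCongruenceLevel n F 𝔫).comap (GLn.ofFinite n F) :
          Subgroup (GL (Fin n) (FiniteAdeleRing (𝓞 F) F))) :
            Set (GL (Fin n) (FiniteAdeleRing (𝓞 F) F))) := by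
    ext h
    simp only [SetLike.mem_coe, Subgroup.mem_comap, Subgroup.coe_subtype]
    constructor
    · intro hh
      obtain ⟨g, u, rfl⟩ := h
      exact ⟨u, hh, rfl⟩
    · rintro ⟨u, hu, rfl⟩
      exact hu
  rw [e]
  exact (isCompact_comap_ofFinite_principalCongruenceLevel n F h𝔫).image hcont

set_option maxHeartbeats 800000 in
/-- **Hecke operators act on `H^q(𝔤, K_∞; π ⊗ E_wt(ℂ))^U` by the Satake scalars** (cofinitely).
For a cuspidal `π` of `GL_n(𝔸_F)` satisfying the tree's per-`π` Flath statement (hypothesis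
`hS`), a compact open `U ≤ GL_n(𝔸_F^∞)` and a weight `wt`: outside a finite set of places, `π`
has a Satake parameter `α_w` at `w` and, for all `j ≤ n` and all `U`-invariant classes `ξ`,
`T_{w,j} ξ = q_w^{j(n-j)/2} e_j(α_w) • ξ`.  Assembly of: the level `K(𝔫)`, `𝔫 = 𝔫_U 𝔫_π`
(`exists_principalCongruenceLevel_sndHom_mem`, `exists_principalCongruenceLevel_fixed`); the good
places (`exists_goodPlaces`); `T_{w,j} = H^q(A ⊗ 1)`, `A = ∑_{y} r(ι_w y)`
(`heckeTWt_eq_rTensorCohomologyHom_sum`); `A = c` on `π^{K_f(𝔫)}`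
(`exists_hasSatakeParamAt_and_sum_rightTranslation_sub_smul_mem_of_sub_mem`); and
`H^q(A ⊗ 1) = c` on `K_f(𝔫)`-invariant classes (`rTensorCohomologyHom_eq_smul_of_forall_fixed`).
[cite: Harder1987, §3] [cite: FlathCorvallis1979, Thm. 3] [cite: BorelWallach2000, I §5.1] -/
theorem exists_finite_heckeTWt_eq_satake_smul
    (hS : π.1.Flath1979_heckeOperator_ofLocal_sub_smul_mem) (q : ℕ)
    (hUo : IsOpen (U : Set (BigHeckeGLn.FiniteAdelicGL n F)))
    (hUc : IsCompact (U : Set (BigHeckeGLn.FiniteAdelicGL n F))) :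
    ∃ S₀ : Set (HeightOneSpectrum (𝓞 F)), S₀.Finite ∧ ∀ w, w ∉ S₀ →
      ∃ α : Multiset ℂ, π.1.HasSatakeParamAt w α ∧ ∀ j ≤ n,
        ∀ ξ ∈ π.cohomologyWtLevel wt U q,
          π.heckeTWt wt U q w j ξ =
            ((((Real.sqrt (w.residueCard : ℝ) : ℝ) : ℂ) ^ (j * (n - j)) * α.esymm j)) • ξ := by
  classical
  obtain ⟨𝔫U, h𝔫U, hU𝔫⟩ :=
    BigHeckeGLn.exists_principalCongruenceLevel_sndHom_mem (n := n) (K := F) hUo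
  obtain ⟨𝔫π, h𝔫π, φ, hφW, hφW', hfixφ⟩ := π.1.exists_principalCongruenceLevel_fixed
  have h𝔫 : 𝔫U * 𝔫π ≠ 0 := mul_ne_zero h𝔫U h𝔫π
  have hleU : principalCongruenceLevel n F (𝔫U * 𝔫π) ≤ principalCongruenceLevel n F 𝔫U :=
    principalCongruenceLevel_mono (n := n) (K := F) h𝔫 Ideal.mul_le_right
  have hleπ : principalCongruenceLevel n F (𝔫U * 𝔫π) ≤ principalCongruenceLevel n F 𝔫π :=
    principalCongruenceLevel_mono (n := n) (K := F) h𝔫 Ideal.mul_le_left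
  obtain ⟨S₁, hS₁, hunr, -⟩ := BigHeckeGLn.exists_goodPlaces hUo hUc
  refine ⟨S₁ ∪ {v | v.asIdeal ∣ 𝔫U * 𝔫π}, hS₁.union (Ideal.finite_factors h𝔫), fun w hw => ?_⟩
  rw [Set.mem_union, not_or] at hw
  obtain ⟨hw₁, hw₂⟩ := hw
  have hw𝔫 : ¬ w.asIdeal ∣ 𝔫U * 𝔫π := hw₂
  obtain ⟨α, hα, hmod⟩ :=
    π.1.exists_hasSatakeParamAt_and_sum_rightTranslation_sub_smul_mem_of_sub_mem hS h𝔫 hw𝔫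
      hφW hφW' (fun u hu => hfixφ u (hleπ hu))
  refine ⟨α, hα, fun j hj ξ hξ => ?_⟩
  -- local data at `w`: `ι_w(t_j) = T_{w,j}`, a transversal of the finite `K_w t_j K_w / K_w`
  have ht := (BigHeckeGLn.heckeElement_eq_ofLocal (n := n) (K := F) w j).symm
  haveI := isHeckeTriple_top_of_isCompact_isOpen _
    (isCompact_valuedCongruenceSubgroup_one n F w) (isOpen_valuedCongruenceSubgroup_one n F w)
  have hfin := finite_orbit_quotient
    (K := (valuedCongruenceSubgroup (Fin n) (1 : WithZero (Multiplicative ℤ)) :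
      Subgroup (GL (Fin n) (w.adicCompletion F))))
    (glDiagonal n (w.adicCompletion F) fun l => if l.val < j then BigHeckeGLn.uniformizerAt w else 1)
  obtain ⟨s, hs⟩ := ArithmeticQuotient.IsUnramifiedLevel.exists_transversal
    (Kᵥ := (valuedCongruenceSubgroup (Fin n) (1 : WithZero (Multiplicative ℤ)) :
      Subgroup (GL (Fin n) (w.adicCompletion F)))) _ hfin
  rw [π.heckeTWt_eq_rTensorCohomologyHom_sum wt U q w j (hunr w hw₁) _ ht s hs hξ]
  haveI : ∀ _τ : F →+* ℂ, Module.Finite ℂ (GLnCohomology.CoeffModule ℂ n wt) := fun _ =>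
    finiteDimensional_coeffModule n wt
  haveI : FiniteDimensional ℂ (ParallelWeight.CoeffModule ℂ F n wt) :=
    inferInstanceAs (Module.Finite ℂ (⨂[ℂ] _τ : (F →+* ℂ), GLnCohomology.CoeffModule ℂ n wt))
  refine π.1.rTensorCohomologyHom_eq_smul_of_forall_fixed
    (restrictK (archGroupGL n F) (archCoeffRep F n wt)) (archCoeffLie F n wt)
    (isGKModule_archCoeff F n wt).ad_compat (AutomorphyDatum.isRegular_gl hcpt)
    π.1.hasLieAction_lieRep q
    ((principalCongruenceLevel n F (𝔫U * 𝔫π)).comap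
      (AutomorphyDatum.gl n F hcpt).finiteAdelic.subtype)
    (isCompact_comap_subtype_principalCongruenceLevel (hcpt := hcpt) h𝔫) _ _ _ _
    (fun x hx => ?_) (fun u hu => ?_)
  · -- `A = c` on the `K_f(𝔫)`-invariant vectors of `π = W / W'`
    obtain ⟨ψ, rfl⟩ := Submodule.Quotient.mk_surjective π.1.kerQuot x
    have hψ : ∀ u ∈ principalCongruenceLevel n F (𝔫U * 𝔫π),
        rightTranslation (AdelicGroupData.gl n F) u ψ - ψ ∈ π.1.W' := by
      intro u hu
      have hu' : GLn.ofFinite n F (GLn.sndHom n F u) = u :=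
        GLn.ofFinite_sndHom_of_mem (principalCongruenceLevel_le n F _ hu)
      have hmem : (⟨u, GLn.sndHom n F u, hu'⟩ : (AutomorphyDatum.gl n F hcpt).finiteAdelic) ∈
          (principalCongruenceLevel n F (𝔫U * 𝔫π)).comap
            (AutomorphyDatum.gl n F hcpt).finiteAdelic.subtype := by
        rw [Subgroup.mem_comap, Subgroup.coe_subtype]
        exact hu
      have h := hx _ hmem
      rw [AutomorphicRepData.finiteRep_mk, Submodule.Quotient.eq] at h
      simpa only [AutomorphicRepData.kerQuot, Submodule.mem_comap, Submodule.coe_subtype,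
        Submodule.coe_sub] using h
    have key := hmod j hj s hs ψ ψ.2 hψ
    have hterm : ∀ y ∈ s,
        π.1.finiteRep ⟨GLn.ofLocal n F w y, ofLocal_mem_finiteAdelic (hcpt := hcpt) w y⟩
          (Submodule.Quotient.mk ψ) =
        π.1.kerQuot.mkQ (π.1.finiteRepW
          ⟨GLn.ofLocal n F w y, ofLocal_mem_finiteAdelic (hcpt := hcpt) w y⟩ ψ) := fun y _ => rfl
    have hsmul : ((((Real.sqrt (w.residueCard : ℝ) : ℝ) : ℂ) ^ (j * (n - j)) * α.esymm j)) •
        (Submodule.Quotient.mk ψ : π.1.Quot) =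
        π.1.kerQuot.mkQ (((((Real.sqrt (w.residueCard : ℝ) : ℝ) : ℂ) ^ (j * (n - j)) *
          α.esymm j)) • ψ) := rfl
    rw [LinearMap.sum_apply, Finset.sum_congr rfl hterm, ← map_sum, hsmul, ← sub_eq_zero,
      ← map_sub, Submodule.mkQ_apply, Submodule.Quotient.mk_eq_zero]
    simp only [AutomorphicRepData.kerQuot, Submodule.mem_comap, Submodule.coe_subtype,
      Submodule.coe_sub, Submodule.coe_smul, AddSubmonoidClass.coe_finsetSum]
    exact key
  · -- `K_f(𝔫)`-invariance of `ξ` (from `U`-invariance, `sndHom K(𝔫_U) ⊆ U`)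
    obtain ⟨g, u₀, rfl⟩ := u
    rw [Subgroup.mem_comap, Subgroup.coe_subtype] at hu
    have hgU : u₀ ∈ U := by
      have h := hU𝔫 _ (hleU hu)
      rwa [GLn.sndHom_ofFinite] at h
    have h := (Representation.mem_fixedPoints _ _ _).1 hξ u₀ hgU
    rw [cohomologyWtRep_apply] at h
    unfold cohomologyWtRepRange at h
    exact h



/-- **Hecke operators act on `H^q(𝔤, K_∞; π ⊗ E_wt(ℂ))^U` by the Satake scalars** — unconditionally:
`exists_finite_heckeTWt_eq_satake_smul` with its Flath hypothesis discharged by the tree's theorem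
`AutomorphicRepData.Flath1979_heckeOperator_ofLocal_sub_smul_mem_holds`
(`AutomorphicRepsGLSatakeFlathProofs`). [cite: Harder1987, §3] [cite: FlathCorvallis1979, Thm. 3] -/
theorem exists_finite_heckeTWt_eq_satake_smul' (q : ℕ)
    (hUo : IsOpen (U : Set (BigHeckeGLn.FiniteAdelicGL n F)))
    (hUc : IsCompact (U : Set (BigHeckeGLn.FiniteAdelicGL n F))) :
    ∃ S₀ : Set (HeightOneSpectrum (𝓞 F)), S₀.Finite ∧ ∀ w, w ∉ S₀ →
      ∃ α : Multiset ℂ, π.1.HasSatakeParamAt w α ∧ ∀ j ≤ n,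
        ∀ ξ ∈ π.cohomologyWtLevel wt U q,
          π.heckeTWt wt U q w j ξ =
            ((((Real.sqrt (w.residueCard : ℝ) : ℝ) : ℂ) ^ (j * (n - j)) * α.esymm j)) • ξ :=
  π.exists_finite_heckeTWt_eq_satake_smul wt U
    (AutomorphicRepData.Flath1979_heckeOperator_ofLocal_sub_smul_mem_holds π.1) q hUo hUc

end CuspidalAutomorphicRepData

end Literature.NumberTheory.Automorphic

end
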